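import Mathlib
import Summits.Ventures.HodgeRepro.Tier4.Target
import Summits.Ventures.HodgeRepro.Tier4.Common.TargetBall
import Summits.Ventures.HodgeRepro.Tier4.Common.TargetCalculus

/-!
# Tier4/Common/TargetJacobian — the explicit automorphy factor of the fractional-linear action:
`jacDetMap (actM M) z = det M / (M (z,1))₂ ^ 3`

Blind re-derivation cell `pub-hodge-repro`, Tier 4 (README §9–§10), seat t4-typer-2 (gen 0).  Target tree path
`lean/Summits/Ventures/HodgeRepro/Tier4/Common/TargetJacobian.lean`.  Imports the FROZEN `Tier4/Target.lean`,
`Tier4/Common/TargetBall.lean` (`mulVec_lift3_apply`, `differentiable_mulVec_lift3`) and `Tier4/Common/TargetCalculus.lean`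
(`pd`, `jacDetMap`, `jacDet_comp`).

WHAT IS PROVED (Mathlib only): the product, inverse and quotient rules for the target's partial derivative `pd`
(`pd_mul`, `pd_inv`, `pd_div`), the partials of the affine coordinates `(M (z,1))ᵢ` (`pd_mulVec_lift3 : pd k (M (·,1))ᵢ = M i k`),
the partials of the fractional-linear action (`pd_actM : ∂_k (M·z)ᵢ = (M_{ik} w₂ − wᵢ M_{2k}) / w₂²`, the sealed
`BallModel.Jac` entry), and **`jacDetMap_actM : jacDetMap (actM M) z = M.det / ((M *ᵥ lift3 z) 2) ^ 3`** whenever the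
denominator is non-zero (expansion of the `2 × 2` determinant of the Jacobian and of `det M` along its third
column, Mathlib `Matrix.det_fin_three`).  With `jacDet_comp` this is the identity
  `jacDet (u ∘ actM M) (v ∘ actM M) z = jacDet u v (M·z) · det M / w₂³`
— the target's Jacobian of a single translate `a ∘ M(r)` of the lifts in closed form; `|det M / w₂³|²` is the
density of the change of variables `∫_{M(D)}` vs `∫_D` on the ball (for `M ∈ U(2,1)`, `|det M| = 1`).

Nothing here says anything about the status of the Hodge conjecture for CM abelian varieties, which is NOT proved
(HC_CM is NOT proved by anyone in this repository).
-/

set_option autoImplicit false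

noncomputable section

namespace Summit.Ventures.HodgeRepro.Tier4

open Matrix

section Rules

variable {u v : (Fin 2 → ℂ) → ℂ} {z : Fin 2 → ℂ}

/-- The product rule for `pd`. -/
theorem pd_mul (k : Fin 2) (hu : DifferentiableAt ℂ u z) (hv : DifferentiableAt ℂ v z) :
    pd k (fun w => u w * v w) z = pd k u z * v z + u z * pd k v z := by
  simp only [pd, fderiv_fun_mul hu hv]
  show u z * fderiv ℂ v z (Pi.single k 1) + v z * fderiv ℂ u z (Pi.single k 1) = _
  ring

/-- The derivative of the inverse of a non-vanishing function. -/
theorem pd_inv (k : Fin 2) (hv : DifferentiableAt ℂ v z) (h0 : v z ≠ 0) :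
    pd k (fun w => (v w)⁻¹) z = -(pd k v z) / v z ^ 2 := by
  have h : HasFDerivAt (fun w => (v w)⁻¹)
      ((ContinuousLinearMap.toSpanSingleton ℂ (-(v z ^ 2)⁻¹) : ℂ →L[ℂ] ℂ).comp (fderiv ℂ v z)) z :=
    (hasFDerivAt_inv h0).comp z hv.hasFDerivAt
  simp only [pd]
  rw [h.fderiv]
  show fderiv ℂ v z (Pi.single k 1) • (-(v z ^ 2)⁻¹) = _
  rw [smul_eq_mul]
  field_simp

/-- The quotient rule for `pd`. -/
theorem pd_div (k : Fin 2) (hu : DifferentiableAt ℂ u z) (hv : DifferentiableAt ℂ v z) (h0 : v z ≠ 0) :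
    pd k (fun w => u w / v w) z = (pd k u z * v z - u z * pd k v z) / v z ^ 2 := by
  have : (fun w => u w / v w) = fun w => u w * (v w)⁻¹ := by funext w; exact div_eq_mul_inv _ _
  have hvi : DifferentiableAt ℂ (fun w => (v w)⁻¹) z := hv.inv h0
  rw [this, pd_mul k hu hvi, pd_inv k hv h0]
  field_simp
  ring

end Rules

section Affine

variable (M : Matrix (Fin 3) (Fin 3) ℂ) (z : Fin 2 → ℂ)

/-- The partials of the coordinate projections. -/
theorem pd_proj (j k : Fin 2) : pd k (fun w : Fin 2 → ℂ => w j) z = if j = k then 1 else 0 := by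
  simp only [pd]
  rw [(hasFDerivAt_apply j z).fderiv]
  simp [ContinuousLinearMap.proj_apply, Pi.single_apply]

/-- The partials of the affine coordinates `(M (z,1))ᵢ`: `∂_k (M (z,1))ᵢ = M i k`. -/
theorem pd_mulVec_lift3 (i : Fin 3) (k : Fin 2) :
    pd k (fun w => (M *ᵥ lift3 w) i) z = M i (Fin.castSucc k) := by
  have e : (fun w : Fin 2 → ℂ => (M *ᵥ lift3 w) i) =
      fun w => ((M i 0 • fun w : Fin 2 → ℂ => w 0) + (M i 1 • fun w : Fin 2 → ℂ => w 1)) w + M i 2 := by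
    funext w; rw [mulVec_lift3_apply]; simp
  have d0 : DifferentiableAt ℂ (M i 0 • fun w : Fin 2 → ℂ => w 0) z := by fun_prop
  have d1 : DifferentiableAt ℂ (M i 1 • fun w : Fin 2 → ℂ => w 1) z := by fun_prop
  rw [e, pd_add_const _ _ (d0.add d1), pd_add _ d0 d1, pd_smul _ _ (by fun_prop), pd_smul _ _ (by fun_prop),
    pd_proj, pd_proj]
  fin_cases k <;> simp

/-- The partials of the fractional-linear action: `∂_k (M·z)ᵢ = (M_{ik} w₂ − wᵢ M_{2k}) / w₂²` with `w = M (z,1)`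
(the sealed `BallModel.Jac` entry), wherever `w₂ ≠ 0`. -/
theorem pd_actM (h2 : (M *ᵥ lift3 z) 2 ≠ 0) (i k : Fin 2) :
    pd k (fun w => actM M w i) z =
      (M (Fin.castSucc i) (Fin.castSucc k) * (M *ᵥ lift3 z) 2 -
        (M *ᵥ lift3 z) (Fin.castSucc i) * M 2 (Fin.castSucc k)) / ((M *ᵥ lift3 z) 2) ^ 2 := by
  have e : (fun w => actM M w i) =
      fun w => (M *ᵥ lift3 w) (Fin.castSucc i) / (M *ᵥ lift3 w) 2 := rfl
  rw [e, pd_div k (differentiable_mulVec_lift3 M _).differentiableAt (differentiable_mulVec_lift3 M 2).differentiableAt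
    h2, pd_mulVec_lift3, pd_mulVec_lift3]

/-- **The automorphy factor**: `jacDetMap (actM M) z = det M / w₂³`, `w = M (z,1)`, wherever `w₂ ≠ 0`. -/
theorem jacDetMap_actM (h2 : (M *ᵥ lift3 z) 2 ≠ 0) :
    jacDetMap (actM M) z = M.det / ((M *ᵥ lift3 z) 2) ^ 3 := by
  have h2' : M 2 0 * z 0 + M 2 1 * z 1 + M 2 2 ≠ 0 := by rwa [mulVec_lift3_apply] at h2
  simp only [jacDetMap, wedge, pd_actM M z h2, Fin.castSucc_zero, Fin.castSucc_one, Matrix.det_fin_three,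
    mulVec_lift3_apply]
  field_simp
  ring

end Affine

end Summit.Ventures.HodgeRepro.Tier4

end
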